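import Literature.NumberTheory.LFunctions.Zhang2022.DHMenuConsistentStripCount
import Literature.NumberTheory.LFunctions.QuadraticCharacterShiftSumsLocal

/-!
# Zhang (2022), rung F-S3, family B-dh — row dhE-13 of `DH.MenuConsistent`: the (A)-world `W(D, χ)` satisfies the
# Bennett–Martin–O'Bryant–Rechnitzer zero-counting row (`Menu.row13`) at every primitive slot

Y. Zhang, *Discrete mean estimates and the Landau–Siegel zero*, arXiv:2211.02515v1 [Zhang2022LandauSiegel] — an unrefereed
manuscript under adjudication. **The programme SEARCHES and TYPES; no claim about Landau–Siegel zeros, Theorems 1–2 of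
arXiv:2211.02515 or a repaired Margin232 until a kernel theorem says so.** Nothing here concerns an actual `L`-function: the
row is checked on the cell's consistency world `DH.world D χ` (p461081/p461386), whose slot `(q, ψ)` carries the RvM picket
fence `½ ± iγ_n(cond ψ)` (plus the real pair `β₁, 1 − β₁` on the induced slots). Cell `landau-siegel`, sub-cell E, stub
S-E-p4-5, row13 of B-dh/SIGMA-E-HANDOVER.md v1 (85415a87d174988f) — «the HARDEST stub».

## The argument (sheet row13, made kernel-checkable)

For a primitive `ψ` mod `q > 1` (hence `q ≥ 3`: mod `2` every character is principal, `eq_one_of_level_two`) and `T ≥ 5/7`: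
`stripCount = 2N` with `N = ⌊(F_q(T)+1)/2⌋₊` on a non-induced slot, `2N + 2` on an induced one (`DHMenuConsistentStripCount`).
* Branch 1 (`ℓ = log(q(T+2)/2π) ≤ 1.567`): induced slots have `q ≥ D`, `ℓ ≥ log D − log 4 > 43248` — vacuous; otherwise
  `N = 0 ⟸ F_q(T) < 1`, and `F_q(T) = (T/π)·log(qT/2πe)` with `q(T+2) ≤ 2πe^{1.567} < 2π·4.793` gives `T/π < 2.5588` and
  `qT/2π < 3.885 ≤ e^{1.36}`, so `F_q(T) < 2.5588 · 0.36 < 1` (`rvmMain_lt_one_of_bmorEll_le`; in-kernel numerics: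
  `Real.exp_bound`, `Real.sum_le_exp_of_nonneg`, `Real.pi_gt_d4/lt_d4`, `Real.exp_one_lt_d9`).
* Branch 2 (`ℓ > 1.567`): `F_q ≥ −2/q ≥ −1` (`rvmMain_ge_neg`), so `|2N − F_q| ≤ 1` and the left side is `≤ 1 + ¼`
  (`≤ 3 + ¼` on induced slots); the right side is `≥ 0.22737·1.567 + 2·0.7 − 0.5 > 1.25` (`log 2.567 ≥ 0.7`), resp.
  `≥ 0.22737·43248 − 0.5` on induced slots.

Main statement: **`world_row13 (hL : 43250 ≤ log D)`** — the field `Menu.row13` of `(world D χ).Menu D χ` verbatim.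
References: [BennettMartinOBryantRechnitzer2021] Thm 1.1 (row dhE-13 as typed in `DirichletLZeroCountExplicit`).
-/

noncomputable section

open scoped Classical
open Complex Set

namespace Literature.NumberTheory.LFunctions.Zhang2022.DH

/-! ### In-kernel numerics -/

/-- `e^{0.567} < 1.7631` (Taylor with remainder, 5 terms). [folklore] -/
private theorem exp_0567_lt : Real.exp 0.567 < 1.7631 := by
  have hx : |(0.567 : ℝ)| ≤ 1 := by rw [abs_of_pos (by norm_num)]; norm_num
  have h := Real.exp_bound hx (n := 5) (by norm_num)
  have h2 := (abs_sub_le_iff.1 h).1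
  simp only [Finset.sum_range_succ, Finset.sum_range_zero, Nat.factorial, abs_of_pos (show (0:ℝ) < 0.567 by norm_num)] at h2
  norm_num at h2
  linarith

/-- `e^{1.567} < 4.793`. [folklore] -/
private theorem exp_1567_lt : Real.exp 1.567 < 4.793 := by
  have e : (1.567 : ℝ) = 1 + 0.567 := by norm_num
  rw [e, Real.exp_add]
  have h := mul_lt_mul'' Real.exp_one_lt_d9 exp_0567_lt (Real.exp_pos 1).le (Real.exp_pos _).le
  linarith

/-- `3.885 ≤ e^{1.36}` (6 Taylor terms from below). [folklore] -/
private theorem le_exp_136 : (3.885 : ℝ) ≤ Real.exp 1.36 := by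
  have h := Real.sum_le_exp_of_nonneg (show (0:ℝ) ≤ 1.36 by norm_num) 6
  simp only [Finset.sum_range_succ, Finset.sum_range_zero, Nat.factorial] at h
  norm_num at h
  linarith

/-- `e^{0.7} ≤ 2.567`. [folklore] -/
private theorem exp_07_le : Real.exp 0.7 ≤ 2.567 := by
  have hx : |(0.7 : ℝ)| ≤ 1 := by rw [abs_of_pos (by norm_num)]; norm_num
  have h := Real.exp_bound hx (n := 4) (by norm_num)
  have h2 := (abs_sub_le_iff.1 h).1
  simp only [Finset.sum_range_succ, Finset.sum_range_zero, Nat.factorial, abs_of_pos (show (0:ℝ) < 0.7 by norm_num)] at h2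
  norm_num at h2
  linarith

/-- `log 4 < 1.3863`. [folklore] -/
private theorem log_four_lt : Real.log 4 < 1.3863 := by
  have : Real.log 4 = 2 * Real.log 2 := by
    rw [show (4:ℝ) = 2 ^ 2 by norm_num, Real.log_pow]; norm_num
  rw [this]; have := Real.log_two_lt_d9; linarith

/-! ### Branch 1: `ℓ ≤ 1.567` forces `F_q(T) < 1` -/

/-- **Branch 1 numerics.** For `q ≥ 3`, `T > 0` and `ℓ = log(q(T+2)/2π) ≤ 1.567`: `F_q(T) = (T/π) log(qT/2πe) < 1` — so no
fence ordinate lies below `T` (`γ_1(q) > T`; worst case `q = 3`, `F_3(8.04) ≈ 0.88`). [cite: BennettMartinOBryantRechnitzer2021, Theorem 1.1] -/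
theorem rvmMain_lt_one_of_bmorEll_le {q : ℕ} (hq : 3 ≤ q) {T : ℝ} (hT : 0 < T) (hℓ : bmorEll q T ≤ 1.567) :
    rvmMain q T < 1 := by
  have hq' : (3:ℝ) ≤ q := by exact_mod_cast hq
  have hπ1 := Real.pi_gt_d4
  have hπ2 := Real.pi_lt_d4
  have hπ := Real.pi_pos
  -- `u := q(T+2)/(2π) ≤ e^{1.567} < 4.793`
  have hu_pos : 0 < (q:ℝ) * (T + 2) / (2 * Real.pi) := by positivity
  have hu : (q:ℝ) * (T + 2) / (2 * Real.pi) < 4.793 := by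
    unfold bmorEll at hℓ
    have := (Real.log_le_iff_le_exp hu_pos).1 hℓ
    linarith [exp_1567_lt]
  have hqT2 : (q:ℝ) * (T + 2) < 4.793 * (2 * Real.pi) := by rwa [div_lt_iff₀ (by positivity)] at hu
  -- `qT < 4.793·2π − 2q ≤ 4.793·2π − 6`, `3T ≤ qT`
  have hqT : (q:ℝ) * T < 4.793 * (2 * Real.pi) - 6 := by nlinarith
  have h3T : 3 * T ≤ (q:ℝ) * T := by nlinarith
  -- `T/π < 2.5588`
  have hTpi : T / Real.pi < 2.5588 := by
    rw [div_lt_iff₀ hπ]; nlinarith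
  have hTpi_pos : 0 < T / Real.pi := by positivity
  -- `qT/2π < 3.885 ≤ e^{1.36}`, so `log(qT/2πe) < 0.36`
  have hy_pos : 0 < (q:ℝ) * T / (2 * Real.pi) := by positivity
  have hy : (q:ℝ) * T / (2 * Real.pi) < 3.885 := by
    rw [div_lt_iff₀ (by positivity)]; nlinarith
  have hlog : Real.log ((q:ℝ) * T / (2 * Real.pi * Real.exp 1)) < 0.36 := by
    rw [← div_div, Real.log_div hy_pos.ne' (Real.exp_pos 1).ne', Real.log_exp]
    have : Real.log ((q:ℝ) * T / (2 * Real.pi)) < 1.36 := by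
      rw [Real.log_lt_iff_lt_exp hy_pos]
      linarith [le_exp_136]
    linarith
  -- conclude
  show T / Real.pi * Real.log ((q:ℝ) * T / (2 * Real.pi * Real.exp 1)) < 1
  rcases le_or_gt (Real.log ((q:ℝ) * T / (2 * Real.pi * Real.exp 1))) 0 with hL0 | hL0
  · exact lt_of_le_of_lt (mul_nonpos_of_nonneg_of_nonpos hTpi_pos.le hL0) one_pos
  · calc T / Real.pi * Real.log ((q:ℝ) * T / (2 * Real.pi * Real.exp 1)) < 2.5588 * 0.36 :=
        mul_lt_mul'' hTpi hlog hTpi_pos.le hL0.le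
      _ < 1 := by norm_num

/-! ### Branch 2: the band -/

/-- `F_f(T) ≥ −2/f` for `T ≥ 0`, `f ≥ 1` (from `x log x ≥ −1/e`). [cite: BennettMartinOBryantRechnitzer2021, Theorem 1.1] -/
theorem rvmMain_ge_neg {f : ℕ} (hf : 1 ≤ f) {T : ℝ} (hT : 0 ≤ T) : -(2 / (f:ℝ)) ≤ rvmMain f T := by
  have hf' : (0:ℝ) < f := by exact_mod_cast hf
  rcases hT.eq_or_lt with h | hTpos
  · rw [← h, rvmMain_zero]
    have : 0 < 2 / (f:ℝ) := by positivity
    linarith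
  · -- `x := fT/(2πe) > 0`, `log x ≥ −1/(e x)` i.e. `log(1/(e x)) ≤ 1/(e x) − 1`
    set x : ℝ := (f:ℝ) * T / (2 * Real.pi * Real.exp 1) with hx
    have hxpos : 0 < x := by positivity
    have hex : 0 < Real.exp 1 * x := by positivity
    have h1 := Real.log_le_sub_one_of_pos (inv_pos.2 hex)
    rw [Real.log_inv, Real.log_mul (Real.exp_pos 1).ne' hxpos.ne', Real.log_exp] at h1
    -- `h1 : -(1 + log x) ≤ (e x)⁻¹ − 1`, i.e. `log x ≥ −(e x)⁻¹`
    have key : (Real.exp 1 * x)⁻¹ = 2 / (f:ℝ) / (T / Real.pi) := by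
      rw [hx]; field_simp
    have hTpi : 0 < T / Real.pi := by positivity
    show -(2 / (f:ℝ)) ≤ T / Real.pi * Real.log x
    have h2 : -(Real.exp 1 * x)⁻¹ ≤ Real.log x := by linarith
    rw [key] at h2
    have h3 := mul_le_mul_of_nonneg_left h2 hTpi.le
    have e : T / Real.pi * -(2 / (f:ℝ) / (T / Real.pi)) = -(2 / (f:ℝ)) := by field_simp
    linarith [h3, e]

/-- `|2⌊(F+1)/2⌋₊ − F| ≤ 1` for `F ≥ −1`. [cite: BennettMartinOBryantRechnitzer2021, Theorem 1.1] -/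
theorem abs_two_floor_sub_le {F : ℝ} (hF : -1 ≤ F) : |2 * ((⌊(F + 1) / 2⌋₊ : ℕ) : ℝ) - F| ≤ 1 := by
  have hx : 0 ≤ (F + 1) / 2 := by linarith
  have h1 := Nat.floor_le hx
  have h2 := Nat.lt_floor_add_one ((F + 1) / 2)
  rw [abs_le]; constructor <;> linarith

/-- The BMOR right-hand side exceeds `1.25` once `ℓ > 1.567` (`log 2.567 ≥ 0.7`). [cite: BennettMartinOBryantRechnitzer2021, Theorem 1.1] -/
theorem bmor_rhs_ge {ℓ : ℝ} (hℓ : 1.567 < ℓ) : (1.25 : ℝ) ≤ 0.22737 * ℓ + 2 * Real.log (1 + ℓ) - 0.5 := by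
  have hpos : 0 < 1 + ℓ := by linarith
  have hlog : 0.7 ≤ Real.log (1 + ℓ) := by
    rw [Real.le_log_iff_exp_le hpos]; linarith [exp_07_le]
  linarith

/-- The BMOR right-hand side exceeds `3.25` once `ℓ ≥ 43248`. [cite: BennettMartinOBryantRechnitzer2021, Theorem 1.1] -/
theorem bmor_rhs_ge_large {ℓ : ℝ} (hℓ : 43248 ≤ ℓ) : (3.25 : ℝ) ≤ 0.22737 * ℓ + 2 * Real.log (1 + ℓ) - 0.5 := by
  have hlog : 0 ≤ Real.log (1 + ℓ) := Real.log_nonneg (by linarith)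
  linarith

/-- On a slot of level `q ≥ D` (`log D ≥ 43250`) and height `T ≥ 5/7`, `ℓ = log(q(T+2)/2π) ≥ 43248`.
[cite: BennettMartinOBryantRechnitzer2021, Theorem 1.1] -/
theorem bmorEll_ge_of_level_ge {D q : ℕ} (hL : (43250 : ℝ) ≤ Real.log D) (hDq : (D : ℝ) ≤ q) {T : ℝ} (hT : 5 / 7 ≤ T) :
    (43248 : ℝ) ≤ bmorEll q T := by
  have hD : (0:ℝ) < D := cast_pos_of_hL hL
  have hπ2 := Real.pi_lt_d4
  unfold bmorEll
  have h1 : (D : ℝ) / 4 ≤ (q : ℝ) * (T + 2) / (2 * Real.pi) := by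
    rw [div_le_div_iff₀ (by norm_num) (by positivity)]
    nlinarith
  have h2 : Real.log ((D:ℝ) / 4) ≤ Real.log ((q : ℝ) * (T + 2) / (2 * Real.pi)) :=
    Real.log_le_log (by positivity) h1
  rw [Real.log_div hD.ne' (by norm_num)] at h2
  linarith [log_four_lt]

/-- A primitive character of level `q > 1` has `q ≥ 3` (mod `2` every character is principal).
[cite: MontgomeryVaughan2007, §9.3] -/
theorem three_le_of_isPrimitive {q : ℕ} [NeZero q] (hq : 1 < q) (ψ : DirichletCharacter ℂ q) (hψ : ψ.IsPrimitive) :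
    3 ≤ q := by
  by_contra h
  obtain rfl : q = 2 := by omega
  have h1 := Literature.NumberTheory.LFunctions.eq_one_of_level_two ψ
  rw [DirichletCharacter.isPrimitive_def, h1, DirichletCharacter.conductor_one] at hψ
  exact absurd hψ (by norm_num)

/-- `|(−1)^a / 4| = 1/4`-bookkeeping: `(−1)^a = ±1`. [folklore] -/
private theorem neg_one_pow_div_four (a : ℕ) : (-1 : ℝ) ^ a / 4 = 1 / 4 ∨ (-1 : ℝ) ^ a / 4 = -(1 / 4) := by
  rcases neg_one_pow_eq_or ℝ a with h | h <;> rw [h] <;> norm_num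

/-! ### Row dhE-13 on the world -/

/-- **Row dhE-13 (Bennett–Martin–O'Bryant–Rechnitzer, Thm 1.1) HOLDS in `W(D, χ)`** (`log D ≥ 43250`): for every primitive
`ψ` mod `q > 1` and `T ≥ 5/7`, `ℓ ≤ 1.567 ⇒ N(T) = 0`, and `ℓ > 1.567 ⇒ |N(T) − F_q(T) − ψ(−1)/4| ≤ 0.22737ℓ + 2log(1+ℓ) − ½`,
where `N(T) = (world D χ).stripCount q ψ T`. The field `Menu.row13` verbatim. [cite: BennettMartinOBryantRechnitzer2021, Theorem 1.1] -/
theorem world_row13 {D : ℕ} {χ : DirichletCharacter ℂ D} (hL : (43250 : ℝ) ≤ Real.log D) :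
    ∀ (q : ℕ) [NeZero q], 1 < q → ∀ ψ : DirichletCharacter ℂ q, ψ.IsPrimitive → ∀ T : ℝ, 5 / 7 ≤ T →
      (bmorEll q T ≤ 1.567 → (world D χ).stripCount q ψ T = 0) ∧
      (1.567 < bmorEll q T →
        |((world D χ).stripCount q ψ T : ℝ) - (T / Real.pi * Real.log (q * T / (2 * Real.pi * Real.exp 1)) -
            (-1) ^ charParity ψ / 4)| ≤
          0.22737 * bmorEll q T + 2 * Real.log (1 + bmorEll q T) - 0.5) := by
  intro q _ hq ψ hψ T hT
  have hq3 : 3 ≤ q := three_le_of_isPrimitive hq ψ hψ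
  have hq1 : 1 ≤ q := by omega
  have hq3' : (3:ℝ) ≤ q := by exact_mod_cast hq3
  have hcond : ψ.conductor = q := (DirichletCharacter.isPrimitive_def ψ).1 hψ
  have hT0 : 0 ≤ T := by linarith
  have hTpos : 0 < T := by linarith
  have eF : T / Real.pi * Real.log ((q : ℝ) * T / (2 * Real.pi * Real.exp 1)) = rvmMain q T := rfl
  -- `F ≥ −2/q ≥ −1`, so `|2N − F| ≤ 1`
  have hFge : -1 ≤ rvmMain q T := by
    have h := rvmMain_ge_neg hq1 hT0
    have : 2 / (q:ℝ) ≤ 1 := by rw [div_le_one (by positivity)]; linarith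
    linarith
  have hband := abs_two_floor_sub_le hFge
  have hband' := abs_le.1 hband
  have hsign := neg_one_pow_div_four (charParity ψ)
  rw [eF]
  by_cases hexc : IsExcSlot D χ q ψ
  · -- induced slot: `q ≥ D`, `ℓ ≥ 43248`; branch 1 vacuous, branch 2 from `3.25 ≤ RHS`
    have hℓ := bmorEll_ge_of_level_ge hL (IsExcSlot.cast_le hexc) hT
    refine ⟨fun h => by exfalso; linarith, fun _ => ?_⟩
    rw [stripCount_world_of_exc hL hexc hT0, hcond]
    have hR := bmor_rhs_ge_large hℓ
    push_cast
    rw [abs_le]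
    unfold fenceCount at hband' ⊢
    rcases hsign with hs | hs <;> rw [hs] <;> constructor <;> linarith [hband'.1, hband'.2]
  · refine ⟨fun h => ?_, fun h => ?_⟩
    · -- branch 1: `F < 1 ⇒ N = 0`
      rw [stripCount_world_of_not_exc χ hexc hT0, hcond]
      have hF : rvmMain q T < 1 := rvmMain_lt_one_of_bmorEll_le hq3 hTpos h
      have : fenceCount q T = 0 := by
        unfold fenceCount; rw [Nat.floor_eq_zero]; linarith
      rw [this]
    · -- branch 2: `|2N − F ∓ ¼| ≤ 1.25 ≤ RHS`
      rw [stripCount_world_of_not_exc χ hexc hT0, hcond]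
      have hR := bmor_rhs_ge h
      push_cast
      rw [abs_le]
      unfold fenceCount at hband' ⊢
      rcases hsign with hs | hs <;> rw [hs] <;> constructor <;> linarith [hband'.1, hband'.2]

end Literature.NumberTheory.LFunctions.Zhang2022.DH
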